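import Mathlib
import HarnessLib
import Summits.Ventures.LatticeQCDFlow.Exactness.CPNLeapfrogHMCErgodic
import Summits.Ventures.LatticeQCDFlow.Exactness.NCMCGeneralSpaceDoeblinPowerCLT
import Summits.Ventures.LatticeQCDFlow.Scoring.DoeblinPowerBatchMeansCLT
import Summits.Ventures.LatticeQCDFlow.Scoring.DoeblinPowerBatchMeansTauInt

/-!
# The `cpn_2d` engine's single-step geodesic leapfrog HMC: its one-step Doeblin certificate, every event a finite `τ_int`, certified burn-in, the CLT and asymptotically exact batch-means error bars from EVERY start

HONEST FRAMING: exact (Metropolis-corrected) sampling algorithms for lattice gauge theory;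
figures of merit are autocorrelation/cost numbers at stated couplings and volumes; no
continuum-physics claim.

Venture `LatticeQCDFlow` (cell pub-lqcd), topic `Exactness`, FANOUT row 9 (eng-latcore, GEN-23; the engine
`latflow.core.cpn_2d` `'hmc'` at `nstep = 1` — STEP-0 of the ladder, the 2D CP(N−1) comparator of the flow samplers).
NEW WORK of the cell over the tree, nothing cited as a fact, no number claimed: gen-16's
`SphereFamilyLeapfrogHMCErgodic.lean` / `CPNLeapfrogHMCErgodic.lean` (`famLeapfrogHMC`, `famLeapfrogHMC_minorised` —
ONE-STEP Doeblin `η · ⊗ uniformSphere ≤ K(x, ·)` at `nstep = 1` for every `δ > 0` and every bounded measurable force,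
`famLeapfrogHMC_invariant_gibbsLaw`, `famGibbsLaw_cpnAction`, `isProbabilityMeasure_famGibbsLaw`,
`cpn_leapfrogHMC_uniformlyErgodic` — convergence only), rows 13 / 8 (`…_of_nHit` consequences).  Row 8's
`Scoring/CPNHeatBathSweepBatchMeans.lean` / `CPNMetropolisSweepBatchMeans.lean` are the `cpn_2d` `'hb'` / `'metro'`
paths; this file is its `'hmc'`.  Printed counterparts NAMED ONLY: Duane–Kennedy–Pendleton–Roweth 1987; Meyn–Tweedie
1993; Flegal–Jones 2010; Madras–Sokal 1988.

## Content (finite sets of sites `V` and links `E`, `src tgt : E → V`, complex structure `J`, couplings `c`; the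
## lattice CP(N−1) law `π = cpnGibbsLaw src tgt J c`; `K = famLeapfrogHMC F δ 1 (cpnAction …)` with ANY measurable
## force field `F` bounded by `b ≥ 0` and ANY step `δ > 0`)

* **`cpn_leapfrogHMC_certificate`** — `K` leaves `π` invariant and `ε' • ⊗ uniformSphere ≤ K(ω, ·) = K^1(ω, ·)` for
  EVERY `ω`, `0 < ε' ≤ 1`.
* **`cpn_leapfrogHMC_tauInt_setACF_le`** (ONE `B`: `τ_int(1_A) ≤ 1/2 + B/(1 − π(A))` for EVERY event — a
  topological sector of the 2D CP(N−1) model, say), **`cpn_leapfrogHMC_timeAverage_bias_le`** (burn-in `B/N'` from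
  EVERY start), **`cpn_leapfrogHMC_timeAverage_clt`**, **`cpn_leapfrogHMC_batchMeans_tendstoInMeasure`**,
  **`cpn_leapfrogHMC_batchMeans_coverage`** (`σ²_f > 0`), **`cpn_leapfrogHMC_tauInt_tendstoInMeasure`** (`Var_π f ≠ 0`).

NOT CLAIMED: `nstep ≥ 2` (the gen-20 multi-step chain is staged, build lane); any value of `ε', B`; the
identification of `F` with the engine's sphere-projected gradient of `βS` (irrelevant to these statements); floating
point.
-/

noncomputable section

namespace Summit.Ventures.LatticeQCDFlow.Exactness

open MeasureTheory Measure Metric Set Real ProbabilityTheory Function Filter Topology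
open Summit.Ventures.LatticeQCDFlow.Scoring (replicaSEsq tauInt autocov kop)
open scoped ENNReal InnerProductSpace

section CPNHMC

variable {V E : Type*} [Fintype V] [Fintype E] {d : ℕ}
  {src tgt : E → V} {J : EuclideanSpace ℝ (Fin (d + 2)) →L[ℝ] EuclideanSpace ℝ (Fin (d + 2))} {c : E → ℝ}

/-- **THE ONE-STEP DOEBLIN CERTIFICATE OF THE `cpn_2d` SINGLE-STEP LEAPFROG HMC**: for every step `δ > 0` and every
measurable force field bounded by `b`, the kernel leaves `cpnGibbsLaw` invariant and dominates
`ε' · ⊗ uniformSphere` from EVERY configuration in ONE step, `0 < ε' ≤ 1`. -/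
theorem cpn_leapfrogHMC_certificate {F : CPNConfig V E d → (Π i, FamE (cpnDim V E d) i)}
    (hF : Measurable F) {δ : ℝ} (hδ : 0 < δ) {b : ℝ} (hb0 : 0 ≤ b) (hb : ∀ ω i, ‖F ω i‖ ≤ b) :
    Kernel.Invariant (famLeapfrogHMC (k := cpnDim V E d) F δ 1 hF (cpnAction src tgt J c)) (cpnGibbsLaw src tgt J c) ∧
      ∃ ε' : ℝ≥0∞, 0 < ε' ∧ ε' ≤ 1 ∧ ∀ ω : CPNConfig V E d,
        ε' • (Measure.pi fun i => uniformSphere (volume : Measure (FamE (cpnDim V E d) i))) ≤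
          nHit (famLeapfrogHMC (k := cpnDim V E d) F δ 1 hF (cpnAction src tgt J c)) 1 ω := by
  obtain ⟨s, hs⟩ := exists_abs_cpnAction_le src tgt J c
  have hS : Measurable (cpnAction src tgt J c) := (continuous_cpnAction src tgt J c).measurable
  obtain ⟨η, hη0, hmin⟩ := famLeapfrogHMC_minorised (k := cpnDim V E d) hδ hF hb0 hb hS hs
  haveI : Fact (Measurable (cpnAction src tgt J c)) := ⟨hS⟩
  have hη1 : η ≤ 1 := by
    have h := Measure.le_iff'.1 (hmin fun _ => sphereDefault) univ
    rwa [Measure.smul_apply, smul_eq_mul, measure_univ, measure_univ, mul_one] at h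
  have hinv : Kernel.Invariant (famLeapfrogHMC (k := cpnDim V E d) F δ 1 hF (cpnAction src tgt J c)) (cpnGibbsLaw src tgt J c) := by
    rw [← famGibbsLaw_cpnAction]
    exact famLeapfrogHMC_invariant_gibbsLaw hF δ 1 hS
  refine ⟨hinv, η, hη0, hη1, fun ω => ?_⟩
  rw [GeneralNCMC.nHit_one]
  exact hmin ω

/-- The lattice CP(N−1) law is a probability law. -/
theorem isProbabilityMeasure_cpnGibbsLaw' :
    IsProbabilityMeasure (cpnGibbsLaw src tgt J c) := by
  obtain ⟨s, hs⟩ := exists_abs_cpnAction_le src tgt J c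
  rw [← famGibbsLaw_cpnAction]
  exact isProbabilityMeasure_famGibbsLaw (k := cpnDim V E d) hs

/-! ## Figures of merit: `τ_int` of every event, burn-in, CLT, batch means, coverage, `τ̂_int` -/

/-- **EVERY EVENT HAS A FINITE `τ_int` UNDER THE `cpn_2d` LEAPFROG HMC — ONE CONSTANT FOR ALL EVENTS**: `B ≥ 0` with
`τ_int(1_A) ≤ 1/2 + B/(1 − π(A))` (scorers' `Scoring.tauInt`) for EVERY measurable `A` with `0 < π(A) < 1`. -/
theorem cpn_leapfrogHMC_tauInt_setACF_le {F : CPNConfig V E d → (Π i, FamE (cpnDim V E d) i)}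
    (hF : Measurable F) {δ : ℝ} (hδ : 0 < δ) {b : ℝ} (hb0 : 0 ≤ b) (hb : ∀ ω i, ‖F ω i‖ ≤ b)
    [IsMarkovKernel (famLeapfrogHMC (k := cpnDim V E d) F δ 1 hF (cpnAction src tgt J c))] :
    ∃ B : ℝ, 0 ≤ B ∧ ∀ A : Set (CPNConfig V E d), MeasurableSet A →
      0 < (cpnGibbsLaw src tgt J c).real A → (cpnGibbsLaw src tgt J c).real A < 1 →
      tauInt (setACF (famLeapfrogHMC (k := cpnDim V E d) F δ 1 hF (cpnAction src tgt J c))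
          (cpnGibbsLaw src tgt J c) A) ≤
        1 / 2 + B / (1 - (cpnGibbsLaw src tgt J c).real A) := by
  haveI := isProbabilityMeasure_cpnGibbsLaw' (src := src) (tgt := tgt) (J := J) (c := c)
  obtain ⟨hinv, ε', hε0, hε1, hmin⟩ := cpn_leapfrogHMC_certificate (src := src) (tgt := tgt) (J := J) (c := c) hF hδ hb0 hb
  have he0 : 0 < ε'.toReal := ENNReal.toReal_pos hε0.ne' (ne_top_of_le_ne_top ENNReal.one_ne_top hε1)
  have he1 : ε'.toReal ≤ 1 := ENNReal.toReal_le_of_le_ofReal zero_le_one (by simpa using hε1)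
  refine ⟨1 / ε'.toReal - 1, ?_, fun A hA h0 h1 => ?_⟩
  · rw [sub_nonneg, le_div_iff₀ he0]; nlinarith
  · simpa using GeneralNCMC.tauInt_setACF_le_of_nHit (GeneralNCMC.minorised_setwise hmin) hε0 hε1
      Nat.one_pos hinv hA h0 h1

/-- **CERTIFIED BURN-IN OF THE `cpn_2d` LEAPFROG HMC FROM EVERY START**: one `B ≥ 0` with
`|E_{μ₀}[(1/N') Σ_{t<N'} q(ω_t)] − ∫ q dπ| ≤ B/N'` for EVERY initial law, every `[0,1]`-valued measurable `q`, `N' ≥ 1`. -/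
theorem cpn_leapfrogHMC_timeAverage_bias_le {F : CPNConfig V E d → (Π i, FamE (cpnDim V E d) i)}
    (hF : Measurable F) {δ : ℝ} (hδ : 0 < δ) {b : ℝ} (hb0 : 0 ≤ b) (hb : ∀ ω i, ‖F ω i‖ ≤ b)
    [IsMarkovKernel (famLeapfrogHMC (k := cpnDim V E d) F δ 1 hF (cpnAction src tgt J c))] :
    ∃ B : ℝ, 0 ≤ B ∧ ∀ (μ₀ : Measure (CPNConfig V E d)) [IsProbabilityMeasure μ₀]
      (q : CPNConfig V E d → ℝ), Measurable q → (∀ ω, 0 ≤ q ω) → (∀ ω, q ω ≤ 1) →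
      ∀ N' : ℕ, N' ≠ 0 →
      |∫ x, (∑ t ∈ Finset.range N', q (x t)) / N'
          ∂(Kernel.trajMeasure (X := fun _ : ℕ => CPNConfig V E d) μ₀
              (fun t : ℕ => (famLeapfrogHMC (k := cpnDim V E d) F δ 1 hF (cpnAction src tgt J c)).comap
                (fun h : (i : ↥(Finset.Iic t)) → CPNConfig V E d =>
                  h ⟨t, Finset.mem_Iic.2 le_rfl⟩) (measurable_pi_apply _)))
        - ∫ ω, q ω ∂(cpnGibbsLaw src tgt J c)| ≤ B / N' := by
  haveI := isProbabilityMeasure_cpnGibbsLaw' (src := src) (tgt := tgt) (J := J) (c := c)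
  obtain ⟨hinv, ε', hε0, hε1, hmin⟩ := cpn_leapfrogHMC_certificate (src := src) (tgt := tgt) (J := J) (c := c) hF hδ hb0 hb
  have he0 : 0 < ε'.toReal := ENNReal.toReal_pos hε0.ne' (ne_top_of_le_ne_top ENNReal.one_ne_top hε1)
  refine ⟨1 / ε'.toReal, by positivity, fun μ₀ _ q hq h0 h1 N' hN => ?_⟩
  calc _ ≤ ((1 : ℕ) : ℝ) / (ε'.toReal * N') :=
        GeneralNCMC.chain_timeAverage_bias_le_of_nHit (GeneralNCMC.minorised_setwise hmin) hε0 hε1 Nat.one_pos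
          hinv μ₀ hq h0 h1 hN
    _ = 1 / ε'.toReal / N' := by rw [Nat.cast_one, div_div]

/-- **THE CLT FOR TIME AVERAGES OF THE `cpn_2d` LEAPFROG HMC, FROM EVERY INITIAL LAW** (`|f| ≤ C` measurable,
`Y ~ N(0, σ²_f)`): `(√N')⁻¹ Σ_{t<N'} (f(ω_t) − π f) ⇒ Y` under `P_{μ₀}`. -/
theorem cpn_leapfrogHMC_timeAverage_clt {F : CPNConfig V E d → (Π i, FamE (cpnDim V E d) i)}
    (hF : Measurable F) {δ : ℝ} (hδ : 0 < δ) {b : ℝ} (hb0 : 0 ≤ b) (hb : ∀ ω i, ‖F ω i‖ ≤ b)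
    [IsMarkovKernel (famLeapfrogHMC (k := cpnDim V E d) F δ 1 hF (cpnAction src tgt J c))]
    {f : CPNConfig V E d → ℝ} (hf : Measurable f) {C : ℝ} (hC : ∀ ω, |f ω| ≤ C)
    (μ₀ : Measure (CPNConfig V E d)) [IsProbabilityMeasure μ₀]
    [IsProbabilityMeasure (Kernel.trajMeasure (X := fun _ : ℕ => CPNConfig V E d) μ₀
              (fun t : ℕ => (famLeapfrogHMC (k := cpnDim V E d) F δ 1 hF (cpnAction src tgt J c)).comap
                (fun h : (i : ↥(Finset.Iic t)) → CPNConfig V E d =>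
                  h ⟨t, Finset.mem_Iic.2 le_rfl⟩) (measurable_pi_apply _)))]
    {Ω' : Type*} [MeasurableSpace Ω'] {P' : Measure Ω'} [IsProbabilityMeasure P'] {Y : Ω' → ℝ}
    (hY : HasLaw Y (gaussianReal 0 (Real.toNNReal
      ((∫ y, (f y - ∫ z, f z ∂(cpnGibbsLaw src tgt J c)) ^ 2 ∂(cpnGibbsLaw src tgt J c))
              + 2 * ∑' k, ∫ y, (f y - ∫ z, f z ∂(cpnGibbsLaw src tgt J c))
                * (kop (famLeapfrogHMC (k := cpnDim V E d) F δ 1 hF (cpnAction src tgt J c)))^[k + 1]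
                  (fun y => f y - ∫ z, f z ∂(cpnGibbsLaw src tgt J c)) y ∂(cpnGibbsLaw src tgt J c)))) P') :
    TendstoInDistribution (fun (N' : ℕ) (x : ℕ → CPNConfig V E d) =>
        (Real.sqrt N')⁻¹ * ∑ t ∈ Finset.range N', (f (x t) - ∫ z, f z ∂(cpnGibbsLaw src tgt J c)))
      atTop Y (fun _ => (Kernel.trajMeasure (X := fun _ : ℕ => CPNConfig V E d) μ₀
              (fun t : ℕ => (famLeapfrogHMC (k := cpnDim V E d) F δ 1 hF (cpnAction src tgt J c)).comap
                (fun h : (i : ↥(Finset.Iic t)) → CPNConfig V E d =>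
                  h ⟨t, Finset.mem_Iic.2 le_rfl⟩) (measurable_pi_apply _)))) P' := by
  haveI := isProbabilityMeasure_cpnGibbsLaw' (src := src) (tgt := tgt) (J := J) (c := c)
  obtain ⟨hinv, ε', hε0, -, hmin⟩ := cpn_leapfrogHMC_certificate (src := src) (tgt := tgt) (J := J) (c := c) hF hδ hb0 hb
  exact GeneralNCMC.tendstoInDistribution_timeAverage_of_nHit hinv hε0.ne' hmin Nat.one_pos hf hC μ₀ hY

/-- **BATCH MEANS ESTIMATE `σ²_f` CONSISTENTLY ALONG THE `cpn_2d` LEAPFROG HMC, FROM EVERY INITIAL LAW.** -/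
theorem cpn_leapfrogHMC_batchMeans_tendstoInMeasure {F : CPNConfig V E d → (Π i, FamE (cpnDim V E d) i)}
    (hF : Measurable F) {δ : ℝ} (hδ : 0 < δ) {b : ℝ} (hb0 : 0 ≤ b) (hb : ∀ ω i, ‖F ω i‖ ≤ b)
    [IsMarkovKernel (famLeapfrogHMC (k := cpnDim V E d) F δ 1 hF (cpnAction src tgt J c))]
    {f : CPNConfig V E d → ℝ} (hf : Measurable f) {C : ℝ} (hC : ∀ ω, |f ω| ≤ C)
    (μ₀ : Measure (CPNConfig V E d)) [IsProbabilityMeasure μ₀]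
    {a b' : ℕ → ℕ} (ha : Tendsto a atTop atTop) (hb' : Tendsto b' atTop atTop) :
    TendstoInMeasure (Kernel.trajMeasure (X := fun _ : ℕ => CPNConfig V E d) μ₀
              (fun t : ℕ => (famLeapfrogHMC (k := cpnDim V E d) F δ 1 hF (cpnAction src tgt J c)).comap
                (fun h : (i : ↥(Finset.Iic t)) → CPNConfig V E d =>
                  h ⟨t, Finset.mem_Iic.2 le_rfl⟩) (measurable_pi_apply _)))
      (fun (N' : ℕ) (x : ℕ → CPNConfig V E d) => ((b' N' * a N' : ℕ) : ℝ)
        * replicaSEsq (fun j (x : ℕ → CPNConfig V E d) =>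
            (∑ i ∈ Finset.range (b' N'), f (x (b' N' * j + i))) / (b' N')) (a N') x)
      atTop (fun _ => (∫ y, (f y - ∫ z, f z ∂(cpnGibbsLaw src tgt J c)) ^ 2 ∂(cpnGibbsLaw src tgt J c))
              + 2 * ∑' k, ∫ y, (f y - ∫ z, f z ∂(cpnGibbsLaw src tgt J c))
                * (kop (famLeapfrogHMC (k := cpnDim V E d) F δ 1 hF (cpnAction src tgt J c)))^[k + 1]
                  (fun y => f y - ∫ z, f z ∂(cpnGibbsLaw src tgt J c)) y ∂(cpnGibbsLaw src tgt J c)) := by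
  haveI := isProbabilityMeasure_cpnGibbsLaw' (src := src) (tgt := tgt) (J := J) (c := c)
  obtain ⟨hinv, ε', hε0, hε1, hmin⟩ := cpn_leapfrogHMC_certificate (src := src) (tgt := tgt) (J := J) (c := c) hF hδ hb0 hb
  exact Scoring.chain_batchMeans_sigmaHat_tendstoInMeasure_of_nHit hinv (GeneralNCMC.minorised_setwise hmin)
    hε0 hε1 Nat.one_pos hf hC μ₀ ha hb'

/-- **THE BATCH-MEANS INTERVAL OF A `cpn_2d` HMC RUN IS ASYMPTOTICALLY EXACT** (`σ²_f > 0`, any initial law, `z > 0`). -/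
theorem cpn_leapfrogHMC_batchMeans_coverage {F : CPNConfig V E d → (Π i, FamE (cpnDim V E d) i)}
    (hF : Measurable F) {δ : ℝ} (hδ : 0 < δ) {b : ℝ} (hb0 : 0 ≤ b) (hb : ∀ ω i, ‖F ω i‖ ≤ b)
    [IsMarkovKernel (famLeapfrogHMC (k := cpnDim V E d) F δ 1 hF (cpnAction src tgt J c))]
    {f : CPNConfig V E d → ℝ} (hf : Measurable f) {C : ℝ} (hC : ∀ ω, |f ω| ≤ C)
    (hσ : 0 < (∫ y, (f y - ∫ z, f z ∂(cpnGibbsLaw src tgt J c)) ^ 2 ∂(cpnGibbsLaw src tgt J c))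
              + 2 * ∑' k, ∫ y, (f y - ∫ z, f z ∂(cpnGibbsLaw src tgt J c))
                * (kop (famLeapfrogHMC (k := cpnDim V E d) F δ 1 hF (cpnAction src tgt J c)))^[k + 1]
                  (fun y => f y - ∫ z, f z ∂(cpnGibbsLaw src tgt J c)) y ∂(cpnGibbsLaw src tgt J c))
    (μ₀ : Measure (CPNConfig V E d)) [IsProbabilityMeasure μ₀]
    {a b' : ℕ → ℕ} (ha : Tendsto a atTop atTop) (hb' : Tendsto b' atTop atTop) {z : ℝ} (hz : 0 < z) :
    Tendsto (fun N' : ℕ => (Kernel.trajMeasure (X := fun _ : ℕ => CPNConfig V E d) μ₀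
              (fun t : ℕ => (famLeapfrogHMC (k := cpnDim V E d) F δ 1 hF (cpnAction src tgt J c)).comap
                (fun h : (i : ↥(Finset.Iic t)) → CPNConfig V E d =>
                  h ⟨t, Finset.mem_Iic.2 le_rfl⟩) (measurable_pi_apply _))).real
      {x | |((Real.sqrt ((b' N' * a N' : ℕ) : ℝ))⁻¹
          * ∑ t ∈ Finset.range (b' N' * a N'), (f (x t) - ∫ z, f z ∂(cpnGibbsLaw src tgt J c)))
        / Real.sqrt (((b' N' * a N' : ℕ) : ℝ)
          * replicaSEsq (fun j (x : ℕ → CPNConfig V E d) =>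
              (∑ i ∈ Finset.range (b' N'), f (x (b' N' * j + i))) / (b' N')) (a N') x)| ≤ z})
      atTop (𝓝 ((gaussianReal 0 1).real (Set.Icc (-z) z))) := by
  haveI := isProbabilityMeasure_cpnGibbsLaw' (src := src) (tgt := tgt) (J := J) (c := c)
  obtain ⟨hinv, ε', hε0, hε1, hmin⟩ := cpn_leapfrogHMC_certificate (src := src) (tgt := tgt) (J := J) (c := c) hF hδ hb0 hb
  exact Scoring.doeblinPower_batchMeans_studentized_coverage hinv hmin hε0 hε1 Nat.one_pos hf hC hσ μ₀ ha hb' hz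

/-- **THE REPORTED `τ̂_int = σ̂²_BM/(2 v̂)` OF A `cpn_2d` HMC RUN IS CONSISTENT** (`Var_π f ≠ 0`, any initial law). -/
theorem cpn_leapfrogHMC_tauInt_tendstoInMeasure {F : CPNConfig V E d → (Π i, FamE (cpnDim V E d) i)}
    (hF : Measurable F) {δ : ℝ} (hδ : 0 < δ) {b : ℝ} (hb0 : 0 ≤ b) (hb : ∀ ω i, ‖F ω i‖ ≤ b)
    [IsMarkovKernel (famLeapfrogHMC (k := cpnDim V E d) F δ 1 hF (cpnAction src tgt J c))]
    {f : CPNConfig V E d → ℝ} (hf : Measurable f) {C : ℝ} (hC : ∀ ω, |f ω| ≤ C)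
    (hvar : autocov (famLeapfrogHMC (k := cpnDim V E d) F δ 1 hF (cpnAction src tgt J c))
        (cpnGibbsLaw src tgt J c) (fun y => f y - ∫ z, f z ∂(cpnGibbsLaw src tgt J c)) 0 ≠ 0)
    (μ₀ : Measure (CPNConfig V E d)) [IsProbabilityMeasure μ₀]
    {a b' : ℕ → ℕ} (ha : Tendsto a atTop atTop) (hb' : Tendsto b' atTop atTop) :
    TendstoInMeasure (Kernel.trajMeasure (X := fun _ : ℕ => CPNConfig V E d) μ₀
              (fun t : ℕ => (famLeapfrogHMC (k := cpnDim V E d) F δ 1 hF (cpnAction src tgt J c)).comap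
                (fun h : (i : ↥(Finset.Iic t)) → CPNConfig V E d =>
                  h ⟨t, Finset.mem_Iic.2 le_rfl⟩) (measurable_pi_apply _)))
      (fun (N' : ℕ) (x : ℕ → CPNConfig V E d) =>
        (((b' N' * a N' : ℕ) : ℝ)
          * replicaSEsq (fun j (x : ℕ → CPNConfig V E d) =>
              (∑ i ∈ Finset.range (b' N'), f (x (b' N' * j + i))) / (b' N')) (a N') x)
        / (2 * ((∑ t ∈ Finset.range (b' N' * a N'), f (x t) ^ 2) / ((b' N' * a N' : ℕ) : ℝ)
            - ((∑ t ∈ Finset.range (b' N' * a N'), f (x t)) / ((b' N' * a N' : ℕ) : ℝ)) ^ 2)))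
      atTop (fun _ => tauInt (fun t =>
        autocov (famLeapfrogHMC (k := cpnDim V E d) F δ 1 hF (cpnAction src tgt J c))
            (cpnGibbsLaw src tgt J c) (fun y => f y - ∫ z, f z ∂(cpnGibbsLaw src tgt J c)) t
          / autocov (famLeapfrogHMC (k := cpnDim V E d) F δ 1 hF (cpnAction src tgt J c))
            (cpnGibbsLaw src tgt J c) (fun y => f y - ∫ z, f z ∂(cpnGibbsLaw src tgt J c)) 0)) := by
  haveI := isProbabilityMeasure_cpnGibbsLaw' (src := src) (tgt := tgt) (J := J) (c := c)
  obtain ⟨hinv, ε', hε0, hε1, hmin⟩ := cpn_leapfrogHMC_certificate (src := src) (tgt := tgt) (J := J) (c := c) hF hδ hb0 hb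
  exact Scoring.chain_batchMeans_tauInt_tendstoInMeasure_of_nHit hinv hmin hε0 hε1 Nat.one_pos hf hC hvar μ₀ ha hb'

end CPNHMC

end Summit.Ventures.LatticeQCDFlow.Exactness

end
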